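import Summits.AtomisticToContinuum.BoseEinsteinCondensation.Theorems.BECThomsonPrincipleFibreConductanceHealingDefs
import Summits.AtomisticToContinuum.BoseEinsteinCondensation.Theorems.BECThomsonPrincipleFibreConductanceStubKineticBudget
import Summits.AtomisticToContinuum.BoseEinsteinCondensation.Theorems.BECThomsonPrincipleFibreConductanceStubThomson
import Summits.AtomisticToContinuum.BoseEinsteinCondensation.Theorems.BECThomsonPrincipleFibreConductanceStubTwoScaleSplit
import HarnessLib

/-!
# Line `healing-split-kinetic-defect` for crux `FibreConductance` (stmt-AtomisticToContinuum-9480)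
# — lead's reshaped skeleton (r6: + `stub_twoScaleSplit` LANDED p103348; r5: + `stub_thomson` LANDED p103256; r4: + `stub_kineticBudget` LANDED p100839; r3: vocabulary/statements/composition LANDED as
# `Theorems/BECThomsonPrincipleFibreConductanceHealingDefs.lean`, p98647; this file = the seven sorried stubs
# + the closing theorem; lead prover-line-stmt-AtomisticToContinuum-9480-c1-0, 2026-08-16)

**The crux** (`Theses/BECThomsonPrinciple.lean`, `def FibreConductance`): for bounded repulsive
finite-range `v`, every window parameter `M`, every exact zero-free `C¹` minimiser `Φ` on the torus and
every window mode `k = 2πn/L`, `2π‖n‖/L ≤ M√ρ`: ONE flow `J` in the `x₀`-fibre with weak divergence the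
fibre-neutral charge `q = L^{-3/2}(e^{ik·x₀}ψ − βψ²)` and cost `∫|J|²W/ψ² ≤ C L²/‖n‖²`.

**The line (idea `healing-split-kinetic-defect`, planner skeleton r1 `Lines/healing-split-kinetic-defect.lean`),
reshaped by the lead onto the LANDED vocabulary** of `Theorems/BECThomsonPrincipleDefs.lean`
(`fibreW`, `fibrePsi`, `fibreBeta`, `dPsi`, `gradDefect`, `densDefect`, `HasWeakDiv`, `fibreCost`,
`LowDensityWindow`, `GradientCorrectorBound`, `BetaCorrectorBound`, `ShellOccupation`) and closed by the
LANDED `stub_transport : GradientCorrectorBound → BetaCorrectorBound → FibreConductance` (p88851).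
Transport along the conditional amplitude (`J₀ = L^{-3/2}e^{ik·x₀}ψk/(i|k|²)`, cost EXACTLY
`L²/(4π²|n|₂²)`, `div₀J₀ = q + ε♭ + ε♮`) is the landed part; this line supplies the GRADIENT CORRECTOR
(weak divergence `ε♭ = gradDefect`) and consumes the β-corrector as the shared goal `BetaCorrectorBound`
(concluded by gen 0's `stub_betaCorrector` from `DensityFlattening ∧ ShellOccupation`, and by the
parallel line `tagged-path-harnack-cage-moments`' `stub_betaChannel` from `ConditionalDensityMoments ∧
ShellOccupation`; not re-derived here).

The gradient corrector is obtained in DUAL FORM. (1) `stub_thomson` — THE REALISATION HALF OF THOMSON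
DUALITY for fibre flows (new; the tree has only the lower-bound half `norm_pairing_sq_le`): for a
zero-free state and a continuous charge `σ`, a dual bound `‖∫ση‖² ≤ D·∫|∇₀η|²ψ²/W` over all `C¹`
periodic `η` PRODUCES a measurable flow of `σ` of cost `≤ D` (Hahn–Banach on the range of
`η ↦ √(ψ²/W)∇₀η̄` in `L²(cellN; ℂ³)`, Riesz). Hence `GradientCorrectorBound ⟸ GradientDualBound` (glue
`gradientCorrectorBound_of_dual`, proved here) and the crux itself becomes a pure inequality on `Ψ₀`.
(2) `stub_twoScaleSplit` — the dual norm of `ε♭` is split at the HEALING SCALE `ℓ = L/(ν+1)` by block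
averaging over the `(ν+1)³` cubes of the fibre: for ANY admissible field `σ_Q(X̂)` of local weighted
Poincaré factors, ANY admissible field `g_{Q,l}(X̂)` of edge conductances and ANY admissible lattice
dual-norm field `κ(X̂)` (the three DEFINED by their inequalities — `IsPoincareField`,
`IsConductanceField`, `IsLatticeDualField` — so that no `⨆` over test functions sits inside an
integral: the planner's `cubePoincare`/`edgeCond`/`coarseDual` are not measurably manipulable),
`‖∫ε♭η‖² ≤ (2ℓ²·cageIntegral σ + 12·coarseIntegral κ)·∫|∇₀η|²ψ²/W` (two Cauchy–Schwarz localisations;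
each cube lies on six directed edges). (3) `stub_kineticBudget` — `T(Φ) ≤ C_Fρ̄aN` and fibre Fisher
information `∫W|∇₀ψ|² ≤ C_Fρ̄a` for exact zero-free minimisers (diamagnetic + Bose symmetry + Dyson's
PROVED bound; the input of (4) and (5)). (4) `stub_cageMoments` — THE CAGE HALF at the fine scale
(open; uses (H1)): an admissible Poincaré field with `ℓ²·cageIntegral σ ≤ C₃L²/‖n‖²`. (5)
`stub_coarseScale` — THE COARSE SCALE (open; uses (H1); = the planner's `coarseCages` (random-conductance
comparison, GKZ detours) + `beatCount` (flat lattice norm, diagonal in lattice Fourier modes, resonant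
beat shell paid by the occupation input), with the input at the MINIMAL strength `ShellOccupation` — no
structure factor is needed for `ε♭`, whose cube charges carry `β` only through the `y`-constant term
`β/L³`, killed by neutrality): admissible `(g, κ)` with `coarseIntegral κ ≤ C_cL²/‖n‖²`.
(6) `stub_shellOccupation` — the crux's thermodynamic-limit content at the minimal strength the crux
forces (shared VERBATIM with lines parseval-shell-bootstrap and tagged-path-harnack-cage-moments;
crux-sized: `infraredNecessity` p90785). (7) `stub_betaCorrector` — the shared β-channel goal.

Composition (sorry-free, this file): `FibreConductance_of th kb sp cm cs s b =
stub_transport (gradientCorrectorBound_of_dual th (gradientDualBound_of kb sp cm cs s)) b`.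

**Disproof.lean v7 honoured.** (H1) (`not_fibreConductanceNearMinimiser`) binds `stub_kineticBudget`
(`T ≤ E₀`), `stub_cageMoments`, `stub_coarseScale`, `stub_shellOccupation`, `stub_betaCorrector`; the
deterministic `stub_thomson`/`stub_twoScaleSplit` hold for every zero-free state (the slab cage makes
`σ`, `1/g`, `κ` blow up like `e^{2K}`, never the split). §E floor: `stub_transport`'s main term.
§G1/§G3 (`v = 0`): `ψ` constant, `ε♭ ≡ 0`, dual bound `D = 0`, `J♭ = 0`. §Infrared: the reason stub 6
is kept verbatim. Landed `Negative/` lemmas: no stub here is an instance (every bath-law stub keeps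
(H1) exact; stub 6 keeps its half-shell guard).
-/

noncomputable section

namespace Summit.AtomisticToContinuum.BoseEinsteinCondensation.Cruxes.FibreConductance.HealingSplitKineticDefect

open MeasureTheory
open scoped ENNReal
open Literature.MathematicalPhysics.QuantumManyBody.BoseGas
open Summit.AtomisticToContinuum.BoseEinsteinCondensation.Theses.BECThomsonPrinciple (FibreConductance)
open Summit.AtomisticToContinuum.BoseEinsteinCondensation.Cruxes.FibreConductance.ParsevalShellBootstrap

/-! ## §4 Registered stubs -/

-- Stub 1 `stub_thomson` LANDED: Theorems/BECThomsonPrincipleFibreConductanceStubThomson.lean (+ …StubThomsonHilbert.lean p101183).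

-- Stub 2 `stub_kineticBudget` LANDED: Theorems/BECThomsonPrincipleFibreConductanceStubKineticBudget.lean (p100839).

-- Stub 3 `stub_twoScaleSplit` LANDED: Theorems/BECThomsonPrincipleFibreConductanceStubTwoScaleSplit.lean (p103348; helpers p100794).

/-- **Stub 4** (L/XL, the cage half at the healing scale; open): see `CageMoments`.
(Refs: GrimmettKestenZhang1993, §2.) -/
theorem stub_cageMoments : Goal.stub_cageMoments := by
  sorry

/-- **Stub 5** (L/XL, the coarse scale = coarse cages + beat count; open): see `CoarseScale`.
(Refs: GrimmettKestenZhang1993, Thm. 1.) -/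
theorem stub_coarseScale : Goal.stub_coarseScale := by
  sorry

/-- **Stub 6** (XL, HARDEST, the infrared input at the minimal strength the crux forces; shared
verbatim with the sibling lines): see `ParsevalShellBootstrap.ShellOccupation`.
(Refs: KennedyLiebShastry1988.) -/
theorem stub_shellOccupation : Goal.stub_shellOccupation := by
  sorry

/-- **Stub 7** (the shared β-channel goal `BetaCorrectorBound`; concluded by `stub_betaCorrector`
(gen 0, from `DensityFlattening ∧ ShellOccupation`) or by `stub_betaChannel` of line
tagged-path-harnack-cage-moments (from `ConditionalDensityMoments ∧ ShellOccupation`)).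
(Refs: LSSY2005, §1.2 (1.17).) -/
theorem stub_betaCorrector : Goal.stub_betaCorrector := by
  sorry

/-! ## §5 Composition (sorry-free): the seven stubs give the crux BY NAME -/

/-- The crux from the REGISTERED stubs (by name): what closes stmt-AtomisticToContinuum-9480 once the
seven `sorry`s are discharged. [folklore] -/
theorem fibreConductance_of_registered_stubs : FibreConductance :=
  FibreConductance_of stub_thomson stub_kineticBudget stub_twoScaleSplit stub_cageMoments
    stub_coarseScale stub_shellOccupation stub_betaCorrector

end Summit.AtomisticToContinuum.BoseEinsteinCondensation.Cruxes.FibreConductance.HealingSplitKineticDefect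

end
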